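import Mathlib

/-!
# Generic leaf-nondegeneracy (stub B of crux `WindLine.WindyGalerkinSteadyZerothLaw`,
# stmt-AnomalousDissipation-11414), tools J: the index count of a parametrised Fredholm map

Helper layer (pure proof file, no definitions; linear algebra over `ℝ`).  Let `T : E → E` be linear
with finite-dimensional kernel and a finite-dimensional complement `C` of its range of the same
dimension (index zero), and let `F : Γ → E` be an injective linear map from a finite-dimensional
parameter space with `range T + range F = E` (transversality).  Then the kernel of the parametrised
linearisation `Λ(ξ, η) = T ξ − F η` on `E × Γ` is finite-dimensional of dimension exactly `dim Γ`
(`finrank_ker_coprod_eq`): with `Γ₁ = F⁻¹(range T)` and a complement `Γ₂`, `F(Γ₂)` is another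
complement of `range T` (so `dim Γ₂ = dim C = dim ker T`), and `ker Λ ≅ ker T × Γ₁` through a linear
section of `T` over its range.  This is the dimension bookkeeping behind the finite-mode Sard argument
(Foias–Temam 1976, p. 26): the solution manifold of the parametrised steady problem has the dimension
of the parameter space.

References: Foias–Temam, LNM 565 (1976), p. 26; Smale, Amer. J. Math. 87 (1965), §1.
-/

noncomputable section

-- D-0017: single-problem summit ⇒ the duplicated namespace segment is by design.
set_option linter.dupNamespace false

open Function

namespace Summit.AnomalousDissipation.AnomalousDissipation.Theorems.WindLineWindyGalerkinSteadyZerothLaw.GenericLeaf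

section IndexCount

variable {E Γ : Type*} [AddCommGroup E] [Module ℝ E] [AddCommGroup Γ] [Module ℝ Γ]
variable (T : E →ₗ[ℝ] E) (F : Γ →ₗ[ℝ] E)

/-! ## §1 Transversal parameters give a complement of the range -/

/-- If `Γ₂` is a complement in `Γ` of `Γ₁ = F⁻¹(range T)` and `range T ⊔ range F = ⊤`, then `F(Γ₂)`
is a complement of `range T`. [folklore] -/
theorem isCompl_range_map (hsurj : LinearMap.range T ⊔ LinearMap.range F = ⊤) {Γ₂ : Submodule ℝ Γ}
    (hΓ : IsCompl ((LinearMap.range T).comap F) Γ₂) : IsCompl (LinearMap.range T) (Γ₂.map F) := by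
  constructor
  · rw [disjoint_iff, Submodule.eq_bot_iff]
    rintro y ⟨hyR, hyF⟩
    obtain ⟨γ, hγ, rfl⟩ := Submodule.mem_map.1 hyF
    have hγ1 : γ ∈ (LinearMap.range T).comap F := hyR
    have hγ0 : γ ∈ (LinearMap.range T).comap F ⊓ Γ₂ := ⟨hγ1, hγ⟩
    rw [hΓ.inf_eq_bot, Submodule.mem_bot] at hγ0
    rw [hγ0, map_zero]
  · rw [codisjoint_iff, eq_top_iff, ← hsurj, sup_le_iff]
    refine ⟨le_sup_left, ?_⟩
    rintro _ ⟨γ, rfl⟩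
    have hγ : γ ∈ (LinearMap.range T).comap F ⊔ Γ₂ := by rw [hΓ.sup_eq_top]; trivial
    obtain ⟨γ₁, hγ₁, γ₂, hγ₂, rfl⟩ := Submodule.mem_sup.1 hγ
    rw [map_add]
    exact Submodule.add_mem _ (Submodule.mem_sup_left hγ₁) (Submodule.mem_sup_right ⟨γ₂, hγ₂, rfl⟩)

/-- Two complements of the same subspace have the same dimension (both are isomorphic to the
quotient). [folklore] -/
theorem finrank_eq_of_isCompl_of_isCompl {R C C' : Submodule ℝ E} (h : IsCompl R C) (h' : IsCompl R C')
    [FiniteDimensional ℝ C] : FiniteDimensional ℝ C' ∧ Module.finrank ℝ C' = Module.finrank ℝ C := by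
  set e : C ≃ₗ[ℝ] C' := (Submodule.quotientEquivOfIsCompl R C h).symm.trans (Submodule.quotientEquivOfIsCompl R C' h')
  exact ⟨LinearEquiv.finiteDimensional e, (LinearEquiv.finrank_eq e).symm⟩

/-! ## §2 The kernel of the parametrised linearisation -/

/-- **The kernel of `Λ(ξ,η) = T ξ − F η` is isomorphic to `ker T × F⁻¹(range T)`** (through a linear
section of `T` over its range). [folklore] -/
theorem exists_ker_coprod_equiv :
    Nonempty (LinearMap.ker (T.coprod (-F)) ≃ₗ[ℝ] (LinearMap.ker T × (LinearMap.range T).comap F)) := by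
  -- a linear section of `T` over its range
  obtain ⟨σ, hσ⟩ := LinearMap.exists_rightInverse_of_surjective T.rangeRestrict (LinearMap.range_rangeRestrict T)
  have hσx : ∀ r : LinearMap.range T, T (σ r) = r := fun r => by
    have h := congrArg (fun f => ((f r : LinearMap.range T) : E)) hσ
    simpa using h
  -- membership in the kernel
  have hker : ∀ p : E × Γ, p ∈ LinearMap.ker (T.coprod (-F)) ↔ T p.1 = F p.2 := fun p => by
    rw [LinearMap.mem_ker, LinearMap.coprod_apply, LinearMap.neg_apply, ← sub_eq_add_neg, sub_eq_zero]
  -- the two components of the isomorphism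
  -- `σ` lands in `E`; its values are sections: `T (σ r) = r`
  set φ₁ : E × Γ →ₗ[ℝ] E := LinearMap.fst ℝ E Γ - (σ.comp T.rangeRestrict).comp (LinearMap.fst ℝ E Γ) with hφ₁
  have hφ₁x : ∀ p : E × Γ, φ₁ p = p.1 - σ (T.rangeRestrict p.1) := fun p => rfl
  have hφ₁ker : ∀ p : LinearMap.ker (T.coprod (-F)), φ₁ (p : E × Γ) ∈ LinearMap.ker T := fun p => by
    rw [LinearMap.mem_ker, hφ₁x, map_sub, hσx, LinearMap.codRestrict_apply, sub_self]
  have hφ₂ker : ∀ p : LinearMap.ker (T.coprod (-F)), (p : E × Γ).2 ∈ (LinearMap.range T).comap F := fun p => by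
    change F (p : E × Γ).2 ∈ LinearMap.range T
    rw [← (hker _).1 p.2]
    exact ⟨_, rfl⟩
  set Φ : LinearMap.ker (T.coprod (-F)) →ₗ[ℝ] (LinearMap.ker T × (LinearMap.range T).comap F) :=
    ((φ₁.comp (LinearMap.ker (T.coprod (-F))).subtype).codRestrict _ hφ₁ker).prod
      (((LinearMap.snd ℝ E Γ).comp (LinearMap.ker (T.coprod (-F))).subtype).codRestrict _ hφ₂ker) with hΦ
  have hΦ1 : ∀ p, ((Φ p).1 : E) = (p : E × Γ).1 - σ (T.rangeRestrict (p : E × Γ).1) := fun p => rfl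
  have hΦ2 : ∀ p, ((Φ p).2 : Γ) = (p : E × Γ).2 := fun p => rfl
  refine ⟨LinearEquiv.ofBijective Φ ⟨?_, ?_⟩⟩
  · -- injective
    intro p q hpq
    have h1 := congrArg (fun z => ((z.1 : LinearMap.ker T) : E)) hpq
    have h2 := congrArg (fun z => ((z.2 : (LinearMap.range T).comap F) : Γ)) hpq
    simp only [hΦ1, hΦ2] at h1 h2
    have hT : T (p : E × Γ).1 = T (q : E × Γ).1 := by rw [(hker _).1 p.2, (hker _).1 q.2, h2]
    have hrr : T.rangeRestrict (p : E × Γ).1 = T.rangeRestrict (q : E × Γ).1 := Subtype.ext hT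
    rw [hrr] at h1
    have h1' : (p : E × Γ).1 = (q : E × Γ).1 := sub_left_injective h1
    exact Subtype.ext (Prod.ext h1' h2)
  · -- surjective
    rintro ⟨κ, η⟩
    set ξ : E := (κ : E) + σ ⟨F η, η.2⟩ with hξ
    have hTξ : T ξ = F η := by
      rw [hξ, map_add, show T (κ : E) = 0 from κ.2, zero_add, hσx]
    refine ⟨⟨(ξ, (η : Γ)), (hker _).2 hTξ⟩, ?_⟩
    refine Prod.ext (Subtype.ext ?_) (Subtype.ext rfl)
    rw [hΦ1]
    change ξ - σ (T.rangeRestrict ξ) = κ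
    have hrr : T.rangeRestrict ξ = ⟨F η, η.2⟩ := Subtype.ext hTξ
    rw [hrr, hξ, add_sub_cancel_right]

/-- **The index count.**  If `T` has finite-dimensional kernel and a finite-dimensional complement
`C` of its range with `dim C = dim ker T`, `F` is injective from a finite-dimensional `Γ`, and
`range T ⊔ range F = ⊤`, then `ker (T ⊕ (−F))` is finite-dimensional of dimension `dim Γ`. [folklore] -/
theorem finrank_ker_coprod_eq [FiniteDimensional ℝ Γ] [FiniteDimensional ℝ (LinearMap.ker T)]
    (hF : Function.Injective F) (C : Submodule ℝ E) [FiniteDimensional ℝ C] (hC : IsCompl (LinearMap.range T) C)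
    (hind : Module.finrank ℝ C = Module.finrank ℝ (LinearMap.ker T))
    (hsurj : LinearMap.range T ⊔ LinearMap.range F = ⊤) :
    FiniteDimensional ℝ (LinearMap.ker (T.coprod (-F))) ∧
      Module.finrank ℝ (LinearMap.ker (T.coprod (-F))) = Module.finrank ℝ Γ := by
  obtain ⟨Γ₂, hΓ⟩ := Submodule.exists_isCompl ((LinearMap.range T).comap F)
  -- `F(Γ₂)` is a complement of `range T`, of the dimension of `C`
  have hcompl := isCompl_range_map T F hsurj hΓ
  obtain ⟨_, hdim2⟩ := finrank_eq_of_isCompl_of_isCompl hC hcompl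
  have hdimΓ₂ : Module.finrank ℝ Γ₂ = Module.finrank ℝ (LinearMap.ker T) := by
    rw [← hind, ← hdim2]
    exact (LinearEquiv.finrank_eq (Submodule.equivMapOfInjective F hF Γ₂))
  -- `ker Λ ≅ ker T × Γ₁`
  obtain ⟨e⟩ := exists_ker_coprod_equiv T F
  haveI : FiniteDimensional ℝ (LinearMap.ker (T.coprod (-F))) := LinearEquiv.finiteDimensional e.symm
  refine ⟨inferInstance, ?_⟩
  rw [LinearEquiv.finrank_eq e, Module.finrank_prod, ← hdimΓ₂]
  have h := Submodule.finrank_sup_add_finrank_inf_eq ((LinearMap.range T).comap F) Γ₂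
  rw [hΓ.sup_eq_top, hΓ.inf_eq_bot, finrank_bot, add_zero, finrank_top] at h
  omega

end IndexCount

/-! ## §3 Registered sub-goal -/

/-- **Registered sub-goal `genericLeaf_toolsJ`** (worker B of stub `stub_genericLeafNondegeneracy`): the
index count `finrank_ker_coprod_eq` in Pi-form — the kernel of the parametrised linearisation
`(ξ, η) ↦ T ξ − F η` of an index-zero `T` transversal to an injective finite-dimensional `F` has the
dimension of the parameter space. [folklore] -/
theorem genericLeaf_toolsJ : ∀ {E Γ : Type*} [AddCommGroup E] [Module ℝ E] [AddCommGroup Γ] [Module ℝ Γ] (T : E →ₗ[ℝ] E) (F : Γ →ₗ[ℝ] E) [FiniteDimensional ℝ Γ] [FiniteDimensional ℝ (LinearMap.ker T)], Function.Injective F → ∀ (C : Submodule ℝ E) [FiniteDimensional ℝ C], IsCompl (LinearMap.range T) C → Module.finrank ℝ C = Module.finrank ℝ (LinearMap.ker T) → LinearMap.range T ⊔ LinearMap.range F = ⊤ → FiniteDimensional ℝ (LinearMap.ker (T.coprod (-F))) ∧ Module.finrank ℝ (LinearMap.ker (T.coprod (-F))) = Module.finrank ℝ Γ :=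
  fun T F _ _ hF C _ hC hind hsurj => finrank_ker_coprod_eq T F hF C hC hind hsurj

end Summit.AnomalousDissipation.AnomalousDissipation.Theorems.WindLineWindyGalerkinSteadyZerothLaw.GenericLeaf

end
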